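import Summits.HodgeConjecture.HodgeConjecture.Cruxes.BlochSeedDiscOne.Anchor
import Summits.Ventures.HSemireg.Pad4TowerSeedFCUnit
import Summits.Ventures.HSemireg.Pad4TowerSeedB1OddFloor
import Summits.Ventures.HSemireg.Pad4TowerPermCovarianceStatic
import Summits.Ventures.HSemireg.Pad4TowerXInfMu4

/-!
# Negation lens on crux `BlochSeedDiscOne` (stmt-HodgeConjecture-18881), LINE 2 — GHOST-MATE DESCENT and the FLAT THINNING CELL

Sketch of the ideator line `ghost-mate-thinning` (plan-lens-HodgeAV-negation g2, 2026-08-28). PROVED structural lemmas +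
HYPOTHESIS-FORM cell statements + `decide` probes; NO `sorry`, no new axioms. The census seeds `SeedB1Diamond8G1H1` ([S], W3∕W7∕W17,
machine ×3 at instance level) and `SeedFCPCeilingUnitDiamond8G1H1` ((W′), W18 j310554 + j312296, machine ×2) enter ONLY as displayed
binders of the theorems that use them. NOTHING HERE SAYS THAT HC ∕ HC_CM ∕ HC_AV ∕ H2 HOLDS OR FAILS; the crux `BlochSeedDiscOne`
(= `HasHyperbolicBlochSeed 4 1`) is neither proved nor refuted here, and no census row is a theorem about it.

THE LINE IN ONE SENTENCE. Assume STUB R's seed exists at `n = 4` with a static-clean first-order design whose two-level support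
`C ⊆ ◇₈` is FLAT (no symmetry assumed — the census only ever closed SYMMETRIC cells: G₁ (W7∕W16∕W17), ⟨Δ⟩ (W14), ⟨Δ²⟩×S₄ (W20),
and LINE 1 of this seat types the index-2 subgroup cells). The `G₁`-HULL `D = G₁·C` (§5: `satG1`, PROVED to be ◇₈, G₁-closed and —
by RULE-D monotonicity (L-mono) + S₄-covariance (§4, PROVED here) + torus covariance (g53's `ruleDMu4Closed_phaseImage`, tree) —
RULE-D-closed) inherits FC-CORE from `C` (monotone), so by [S] the hull is H₁-KILLED; but every `X+`∕`A2I−` kill is ANTITONE in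
the support's upper level (§2, PROVED: all escape clauses are `∀ P ∈ upper`), so a kill of `D` whose three quantified
participants (head, partner, server) lie in `C` would kill `C` — contradiction. Hence (§3 `ghost_mate`, PROVED): EVERY H₁-kill
of the hull of a flat survivor has a GHOST participant in `G₁·C ∖ C`. Dually (§5 `flatSeed_iff_killedHullThinning`, PROVED under
[S]): the FLAT seed question on ◇₈ is EXACTLY the THINNING question on H₁-KILLED, RULE-D-closed, G₁-closed ◇₈ supports — the
objects famcore (W16 j305149) enumerates nearest to static: minus-`X+` ⇒ the full 97 660-orbit support, minus-`A2I−` ⇒ the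
35-orbit near-model `M₃₅` on the 7-letter alphabet 𝔄₇ = {O, ℓ_u, 2ℓ_u, 3ℓ_u, 4ℓ_u, 2I, 8I}. The typed, encodable forced shape
(§6): `ThinningCell M₃₅` (seconds) and the flat 𝔄₇-cell `FlatSeedA7H1` ∕ `FlatSeedA7Four` (2·19⁴ = 260 642 classes, no orbit
folding — 31× below W8's out-of-reach flat ◇₆, and OUTSIDE THEOREM X∞'s universe 𝒰(μ₄) exactly at its residue R1, the bare
node `2I`, and the apex `8I`: §7 probes); §3b∕§6 add the MIRROR family `A♭₈` of the anomaly seat (LEMMA A∪2I♭, census-neutral until its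
×1 read) as an optional extra hypothesis (`…M` cells), per critic L4′ price (X1). Registered predictions and the cell spec are on the card
`Ideas/ghost-mate-thinning.md`.
-/

set_option linter.dupNamespace false -- `HodgeConjecture.HodgeConjecture` is the tree's Summit/Sub layout (D-0017)

namespace Summit.HodgeConjecture.HodgeConjecture.Cruxes.BlochSeedDiscOne.GhostMate

open Finset Summit.Ventures.HSemireg.Pad4Tower

/-! ## §1 Levelwise inclusion (tree `MConfig.sub`, `Pad4TowerRuleDMu4Dual`), the dual world, and what is MONOTONE -/
/-- inclusion passes to the dual world (`X+`, `A2I+` live on `C.dual 0`). -/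
theorem sub_dual {C D : MConfig} (h : C.sub D) (t : ℤ) : (C.dual t).sub (D.dual t) :=
  ⟨image_subset_image h.2, image_subset_image h.1⟩

/-- a signed FC occurrence is a PRESENCE condition: monotone (LINE 1 `FlipCrossfire.hasSignedFC_mono`, restated over `MConfig.sub`). -/
theorem hasSignedFC_mono {C D : MConfig} (h : C.sub D) {κ : Fin 16} {s : ℤ} (hC : C.HasSignedFC κ s) : D.HasSignedFC κ s := by
  rcases hC with ⟨Z, hZ, hr⟩ | ⟨P, hP, hr⟩
  · exact Or.inl ⟨Z, h.1 hZ, hr⟩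
  · exact Or.inr ⟨P, h.2 hP, hr⟩

/-- **FC-CORE is monotone in the support** (a presence block; LINE 1 `FlipCrossfire.fcCoreBlock_mono`). RULE D is monotone too:
tree `ruleDMu4N_mono` ∕ `ruleDMu4P_mono` (`Pad4TowerRuleDMu4Dual`). The KILL families are NOT monotone — §2 is what replaces it. -/
theorem fcCoreBlock_mono {C D : MConfig} (h : C.sub D) (hC : C.FCCoreBlock) : D.FCCoreBlock := by
  rcases hC with ⟨s, hs, h0, h15, h3, h5, h6, h9, h10, h12⟩ | ⟨t, ht, h1, h2, h4, h8, h7, h11, h13, h14⟩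
  · exact Or.inl ⟨s, hs, hasSignedFC_mono h h0, hasSignedFC_mono h h15, hasSignedFC_mono h h3, hasSignedFC_mono h h5,
      hasSignedFC_mono h h6, hasSignedFC_mono h h9, hasSignedFC_mono h h10, hasSignedFC_mono h h12⟩
  · exact Or.inr ⟨t, ht, hasSignedFC_mono h h1, hasSignedFC_mono h h2, hasSignedFC_mono h h4, hasSignedFC_mono h h8,
      hasSignedFC_mono h h7, hasSignedFC_mono h h11, hasSignedFC_mono h h13, hasSignedFC_mono h h14⟩

/-! ## §2 ANTITONE FIRING: every escape clause of an `X`∕`A2I` instance is a `∀ P ∈ upper` condition (PROVED, by inspection of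
`Pad4TowerXresFamilies.XresXFires` ∕ `XresA2IFires` = xres2s.py `gen_x_w` ∕ `gen_a2i_w`): an instance that fires on the big support with
head, partner and server drawn from the small one fires on the small one. -/

/-- an `X`-instance firing on `D` with participants in `C ⊆ D` (upper levels) fires on `C`. -/
theorem xresXFires_anti {C D : MConfig} (h : C.upper ⊆ D.upper) {Z q n : MCell} {σ u w f : Fin 4}
    (hD : XresXFires D Z q n σ u w f) : XresXFires C Z q n σ u w f := by
  obtain ⟨h1, h2, h3, h4, h5, h6, h7, h8, h9, h10⟩ := hD
  exact ⟨h1, h2, h3, fun P hP => h4 P (h hP), h5, h6, fun P hP => h7 P (h hP), fun P hP => h8 P (h hP),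
    fun P hP => h9 P (h hP), fun P hP => h10 P (h hP)⟩

/-- an `A2I`-instance firing on `D` with participants in `C ⊆ D` (upper levels) fires on `C`. -/
theorem xresA2IFires_anti {C D : MConfig} (h : C.upper ⊆ D.upper) {Z q N' : MCell} {σ u f' v : Fin 4}
    (hD : XresA2IFires D Z q N' σ u f' v) : XresA2IFires C Z q N' σ u f' v := by
  obtain ⟨h1, h2, h3, h4, h5, h6, h7, h8, h9, h10, h11⟩ := hD
  exact ⟨h1, h2, h3, h4, h5, h6, fun P hP => h7 P (h hP), fun P hP => h8 P (h hP), fun P hP => h9 P (h hP),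
    fun P hP => h10 P (h hP), fun P hP => h11 P (h hP)⟩

/-- an `H₁`-KILL OF `D` WITHIN `C`: an `X+` instance (dual world) or an `A2I−` instance firing on `D` whose three quantified
participants — head `Z`, partner `q`, server `n`∕`N′` — all lie in the sub-support `C`. -/
def KilledWithin (C D : MConfig) : Prop :=
  (∃ Z ∈ (C.dual 0).lower, ∃ q ∈ (C.dual 0).upper, ∃ n ∈ (C.dual 0).lower, ∃ σ u w f : Fin 4,
      XresXFires (D.dual 0) Z q n σ u w f) ∨
    ∃ Z ∈ C.lower, ∃ q ∈ C.upper, ∃ N' ∈ C.lower, ∃ σ u f' v : Fin 4, XresA2IFires D Z q N' σ u f' v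

/-- **no kill within an `H₁`-closed sub-support**: if `C ⊆ D` is `X+`- and `A2I−`-closed, no `H₁`-kill of `D` lies within `C`. -/
theorem not_killedWithin {C D : MConfig} (h : C.sub D) (hX : XPlusClosed C) (hA : A2IMinusClosed C) : ¬ KilledWithin C D := by
  rintro (⟨Z, hZ, q, hq, n, hn, σ, u, w, f, hf⟩ | ⟨Z, hZ, q, hq, N', hN', σ, u, f', v, hf⟩)
  · exact hX Z hZ q hq n hn σ u w f (xresXFires_anti (sub_dual h 0).2 hf)
  · exact hA Z hZ q hq N' hN' σ u f' v (xresA2IFires_anti h.2 hf)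

/-- **every kill has a GHOST**: if `C ⊆ D`, `C` is `H₁`-closed and `D` is `H₁`-killed, then some `X+` or `A2I−` instance fires on
`D` with at least one of its three quantified participants OUTSIDE `C` (a ghost). -/
theorem ghost_participant {C D : MConfig} (h : C.sub D) (hX : XPlusClosed C) (hA : A2IMinusClosed C)
    (hD : ¬ (XPlusClosed D ∧ A2IMinusClosed D)) :
    (∃ Z ∈ (D.dual 0).lower, ∃ q ∈ (D.dual 0).upper, ∃ n ∈ (D.dual 0).lower, ∃ σ u w f : Fin 4,
        XresXFires (D.dual 0) Z q n σ u w f ∧ (Z ∉ (C.dual 0).lower ∨ q ∉ (C.dual 0).upper ∨ n ∉ (C.dual 0).lower)) ∨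
      ∃ Z ∈ D.lower, ∃ q ∈ D.upper, ∃ N' ∈ D.lower, ∃ σ u f' v : Fin 4,
        XresA2IFires D Z q N' σ u f' v ∧ (Z ∉ C.lower ∨ q ∉ C.upper ∨ N' ∉ C.lower) := by
  by_contra hnot
  refine hD ⟨?_, ?_⟩
  · intro Z hZ q hq n hn σ u w f hf
    by_cases hm : Z ∈ (C.dual 0).lower ∧ q ∈ (C.dual 0).upper ∧ n ∈ (C.dual 0).lower
    · exact hX Z hm.1 q hm.2.1 n hm.2.2 σ u w f (xresXFires_anti (sub_dual h 0).2 hf)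
    · exact hnot (Or.inl ⟨Z, hZ, q, hq, n, hn, σ, u, w, f, hf, by tauto⟩)
  · intro Z hZ q hq N' hN' σ u f' v hf
    by_cases hm : Z ∈ C.lower ∧ q ∈ C.upper ∧ N' ∈ C.lower
    · exact hA Z hm.1 q hm.2.1 N' hm.2.2 σ u f' v (xresA2IFires_anti h.2 hf)
    · exact hnot (Or.inr ⟨Z, hZ, q, hq, N', hN', σ, u, f', v, hf, by tauto⟩)

/-! ## §3 GHOST-MATE DESCENT under the census seeds (displayed binders [S] and (W′)) -/

/-- **descent, [S]-form**: an FC-CORE sub-support of a G₁-closed, RULE-D-closed ◇₈ support forces an `H₁`-kill of the big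
support (FC-CORE is a presence block, monotone — LINE 1 `fcCoreBlock_mono`). -/
theorem descent_S (hS : SeedB1Diamond8G1H1) {C D : MConfig} (h : C.sub D) (hU : D.InDiamond 8) (hG : D.G1Closed)
    (hR : RuleDMu4Closed D) (hfc : C.FCCoreBlock) : ¬ (XPlusClosed D ∧ A2IMinusClosed D) :=
  fun hst => hS D hU hG ⟨hR, hst.1, hst.2⟩ (fcCoreBlock_mono h hfc)

/-- **descent, (W′)-form** (W18 j310554 `diag_nonunit_fc` + j312296 `non_pceiling_fc`, UNSAT ×2 each): ONE fully charged
`N`-cell, or one fully charged `P`-cell other than a ceiling unit `[6I+ℓ_u]⁴`, anywhere in the sub-support already forces an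
`H₁`-kill of the big support — no FC-CORE sign pattern needed. -/
theorem descent_W (hW : SeedFCPCeilingUnitDiamond8G1H1) {C D : MConfig} (h : C.sub D) (hU : D.InDiamond 8) (hG : D.G1Closed)
    (hR : RuleDMu4Closed D) (hfc : (∃ Z ∈ C.lower, FCc Z) ∨ ∃ P ∈ C.upper, FCc P ∧ ¬ P.IsCeilingUnit8) :
    ¬ (XPlusClosed D ∧ A2IMinusClosed D) := by
  intro hst
  rcases hfc with ⟨Z, hZ, hZfc⟩ | ⟨P, hP, hPfc, hPnu⟩
  · exact (hW D hU hG ⟨hR, hst.1, hst.2⟩ Z hZfc).1 (h.1 hZ)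
  · exact hPnu ((hW D hU hG ⟨hR, hst.1, hst.2⟩ P hPfc).2 (h.2 hP))

/-- **THE GHOST-MATE LEMMA.** Under [S]: a static-clean (`H₁`-closed) FC-CORE sub-support `C` of a G₁-closed, RULE-D-closed ◇₈
support `D` is attacked only THROUGH GHOSTS — some `X+` or `A2I−` instance fires on `D`, and every such firing instance has a
quantified participant in `D ∖ C`. (By g53's peel decoding, PENCIL-B1ODD v0.4 §5e, the census's 2-literal kill motifs are the
`A2I⁻` SWAP KILL — ghost = the transposed mate `q^τ` — and the `X⁺` CEILING KILL — ghost = the `Δ²`-mate; LINE 1 handles the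
second by subgroups, this line handles the first by THINNING.) -/
theorem ghost_mate (hS : SeedB1Diamond8G1H1) {C D : MConfig} (h : C.sub D) (hU : D.InDiamond 8) (hG : D.G1Closed)
    (hR : RuleDMu4Closed D) (hfc : C.FCCoreBlock) (hX : XPlusClosed C) (hA : A2IMinusClosed C) :
    (∃ Z ∈ (D.dual 0).lower, ∃ q ∈ (D.dual 0).upper, ∃ n ∈ (D.dual 0).lower, ∃ σ u w f : Fin 4,
        XresXFires (D.dual 0) Z q n σ u w f ∧ (Z ∉ (C.dual 0).lower ∨ q ∉ (C.dual 0).upper ∨ n ∉ (C.dual 0).lower)) ∨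
      ∃ Z ∈ D.lower, ∃ q ∈ D.upper, ∃ N' ∈ D.lower, ∃ σ u f' v : Fin 4,
        XresA2IFires D Z q N' σ u f' v ∧ (Z ∉ C.lower ∨ q ∉ C.upper ∨ N' ∉ C.lower) :=
  ghost_participant h hX hA (descent_S hS h hU hG hR hfc)

/-! ## §3b THE MIRROR FAMILY `A♭` (anomaly g2, LEMMA A∪2I♭ memo `LEMMA-A2I-FLAT-b-legs.md` 6cb65576f2121b14 — census-NEUTRAL until
its ×1 referee read, so it enters ONLY as an extra hypothesis of the `…M` cells below; critic L4′ price (X1): new cell jobs report both rule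
sets). `A♭_h C := A2IMinusClosed (C.dual h)`; the ghost lemma holds for it verbatim (same antitone escapes, read on the duals). -/

/-- anomaly g2's b-leg family `A♭_h` = the `A2I`-member of `H1MirrorChirality.StaticH1Mirror h`: `A2I−` read on the reflected support. -/
def AFlat (h : ℤ) (C : MConfig) : Prop := A2IMinusClosed (C.dual h)

/-- `A2I−`-only ghost: a sub-support that is `A2I−`-closed inside an `A2I−`-killed support misses a participant of every firing instance. -/
theorem a2i_ghost {C D : MConfig} (h : C.sub D) (hA : A2IMinusClosed C) (hD : ¬ A2IMinusClosed D) :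
    ∃ Z ∈ D.lower, ∃ q ∈ D.upper, ∃ N' ∈ D.lower, ∃ σ u f' v : Fin 4,
      XresA2IFires D Z q N' σ u f' v ∧ (Z ∉ C.lower ∨ q ∉ C.upper ∨ N' ∉ C.lower) := by
  by_contra hnot
  refine hD ?_
  intro Z hZ q hq N' hN' σ u f' v hf
  by_cases hm : Z ∈ C.lower ∧ q ∈ C.upper ∧ N' ∈ C.lower
  · exact hA Z hm.1 q hm.2.1 N' hm.2.2 σ u f' v (xresA2IFires_anti h.2 hf)
  · exact hnot ⟨Z, hZ, q, hq, N', hN', σ, u, f', v, hf, by tauto⟩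

/-- the same ghost statement for the mirror family, on the reflected supports (`sub_dual`). -/
theorem aflat_ghost {t : ℤ} {C D : MConfig} (h : C.sub D) (hA : AFlat t C) (hD : ¬ AFlat t D) :
    ∃ Z ∈ (D.dual t).lower, ∃ q ∈ (D.dual t).upper, ∃ N' ∈ (D.dual t).lower, ∃ σ u f' v : Fin 4,
      XresA2IFires (D.dual t) Z q N' σ u f' v ∧ (Z ∉ (C.dual t).lower ∨ q ∉ (C.dual t).upper ∨ N' ∉ (C.dual t).lower) :=
  a2i_ghost (sub_dual h t) hA hD

/-! ## §4–§5 (rev 2) `S₄`-covariance of the static game and the `G₁`-hull are now the TREE files `Pad4TowerPermCovariance.lean` ∕ `Pad4TowerPermCovarianceStatic.lean` (LEMMA P: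
`MConfig.permImage`, `ruleDMu4Closed_permImage`, `staticFamilies_permInvariant_familywise`, `satG1`, `sub_satG1`, `g1Closed_satG1`, `inDiamond_satG1`,
`ruleDMu4Closed_satG1`, `satG1_sub`, `inDiamond_sub`, `sub_refl`, `sub_trans`) — used BY NAME below; FLAT ⇔ THINNING (PROVED; [S] as displayed binder where used) -/

/-- **THE FLAT SEED on ◇₈** (no symmetry): no static-clean (`H₁`) FC-CORE two-level support in ◇₈ at all. STRONGER than [S]
(`flatSeed_imp_seedG1`); this is what STUB R's static-clean seed design at `n = 4` needs to FAIL for a ◇₈ carrier to exist.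
Hypothesis form; NOT claimed. -/
def FlatSeed8H1 : Prop := ∀ C : MConfig, C.InDiamond 8 → C.StaticH1 → ¬ C.FCCoreBlock

/-- **THE THINNING CELL of a support `D`**: no levelwise sub-support of `D` is RULE-D-closed, `X+`-closed, `A2I−`-closed and FC-CORE. -/
def ThinningCell (D : MConfig) : Prop := ∀ C : MConfig, C.sub D → C.StaticH1 → ¬ C.FCCoreBlock

/-- thinning of every G₁-closed RULE-D-closed ◇₈ support. -/
def HullThinning8 : Prop := ∀ D : MConfig, D.InDiamond 8 → D.G1Closed → RuleDMu4Closed D → ThinningCell D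

/-- thinning of every `H₁`-KILLED G₁-closed RULE-D-closed ◇₈ support — the objects famcore (W16) enumerates next to static. -/
def KilledHullThinning8 : Prop :=
  ∀ D : MConfig, D.InDiamond 8 → D.G1Closed → RuleDMu4Closed D → ¬ (XPlusClosed D ∧ A2IMinusClosed D) → ThinningCell D

/-- the flat seed implies the `G₁` seed [S]. -/
theorem flatSeed_imp_seedG1 (h : FlatSeed8H1) : SeedB1Diamond8G1H1 := fun C hU _ hst => h C hU hst

/-- flat ⇒ hull thinning (restriction). -/
theorem hullThinning_of_flatSeed (h : FlatSeed8H1) : HullThinning8 :=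
  fun _ hU _ _ C hCD hst => h C (inDiamond_sub hCD hU) hst

/-- **hull thinning ⇒ flat** (the hull construction §5: `C ⊆ G₁·C`, which is ◇₈, G₁-closed and RULE-D-closed). -/
theorem flatSeed_of_hullThinning (h : HullThinning8) : FlatSeed8H1 :=
  fun C hU hst => h (satG1 C) (inDiamond_satG1 hU) (g1Closed_satG1 C) (ruleDMu4Closed_satG1 hst.1) C (sub_satG1 C) hst

/-- **FLAT ⇔ HULL THINNING.** -/
theorem flatSeed_iff_hullThinning : FlatSeed8H1 ↔ HullThinning8 := ⟨hullThinning_of_flatSeed, flatSeed_of_hullThinning⟩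

/-- under [S], static hulls need no thinning check (FC-CORE is monotone), so only KILLED hulls matter. -/
theorem hullThinning_iff_killed (hS : SeedB1Diamond8G1H1) : HullThinning8 ↔ KilledHullThinning8 := by
  refine ⟨fun h D hU hG hR _ => h D hU hG hR, fun h D hU hG hR => ?_⟩
  by_cases hst : XPlusClosed D ∧ A2IMinusClosed D
  · exact fun C hCD _ hfc => hS D hU hG ⟨hR, hst.1, hst.2⟩ (fcCoreBlock_mono hCD hfc)
  · exact h D hU hG hR hst

/-- **FLAT SEED ⇔ THINNING OF THE `H₁`-KILLED RULE-D HULLS** (under the census seed [S] as displayed binder): the forced shape of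
a flat static-clean FC-CORE carrier in ◇₈ is an `H₁`-closed FC-CORE sub-support of an `H₁`-KILLED, G₁-closed, RULE-D-closed ◇₈
support, every kill of which has a ghost (§3). -/
theorem flatSeed_iff_killedHullThinning (hS : SeedB1Diamond8G1H1) : FlatSeed8H1 ↔ KilledHullThinning8 :=
  flatSeed_iff_hullThinning.trans (hullThinning_iff_killed hS)

/-! ## §6 THE TYPED CELLS: the famcore alphabet 𝔄₇ and the flat 𝔄₇-cell (hypothesis form; predictions on the card) -/

/-- **`x ∈ 𝔄₇`** = {O, ℓ_u, 2ℓ_u, 3ℓ_u, 4ℓ_u, 2I, 8I} (`u ∈ μ₄`; 19 letters): the letters used by famcore's minus-`A2I⁻` near-model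
`M₃₅` (W16 j305149, witness `witness-famcore-core_only-minus-A2Im-kissat.json`: 35 orbits, 1 692 cells). Decidable. -/
abbrev InA7 (x : BPoint) : Prop :=
  x = (0, 0, 0) ∨ x = (2, 0, 0) ∨ x = (8, 0, 0) ∨ (1 ≤ x.1 ∧ x.1 ≤ 4 ∧ ∃ k : Fin 4, x = lpt x.1 k)

/-- a support over the alphabet 𝔄₇. -/
abbrev CfgInA7 (C : MConfig) : Prop :=
  (∀ Z ∈ C.lower, ∀ f, InA7 (Z f)) ∧ ∀ P ∈ C.upper, ∀ f, InA7 (P f)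

/-- every 𝔄₇ letter is a ◇₈ letter. -/
theorem inDiamond_of_inA7 {x : BPoint} (h : InA7 x) : InDiamond 8 x := by
  rcases h with rfl | rfl | rfl | ⟨h1, h4, k, hx⟩
  · decide
  · decide
  · decide
  · generalize hc : x.1 = c at h1 h4 hx
    rw [hx]
    interval_cases c <;> fin_cases k <;> decide

/-- an 𝔄₇-support lies in ◇₈. -/
theorem inDiamond_of_inA7_cfg {C : MConfig} (h : CfgInA7 C) : C.InDiamond 8 :=
  ⟨fun Z hZ f => inDiamond_of_inA7 (h.1 Z hZ f), fun P hP f => inDiamond_of_inA7 (h.2 P hP f)⟩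

/-- **CELL T(𝔄₇)-H₁ — the FLAT 𝔄₇-SEED** (hypothesis form, NOT claimed; registered prediction UNSAT = this holds, confidence
moderate-low): no static-clean (`H₁`) FC-CORE two-level support over 𝔄₇. 2·19⁴ = 260 642 class variables, flat. -/
def FlatSeedA7H1 : Prop := ∀ C : MConfig, CfgInA7 C → C.StaticH1 → ¬ C.FCCoreBlock

/-- **CELL T(𝔄₇)-FOUR** (all four instance families `X±`, `A2I±` + RULE D; WEAKER statement, registered prediction UNSAT =
holds, confidence moderate). -/
def FlatSeedA7Four : Prop := ∀ C : MConfig, CfgInA7 C → C.StaticFour → ¬ C.FCCoreBlock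

/-- the H₁ cell decides the four-family cell. -/
theorem flatSeedA7Four_of_H1 (h : FlatSeedA7H1) : FlatSeedA7Four :=
  fun C hA hst => h C hA ⟨hst.1, hst.2.2.1, hst.2.2.2.1⟩

/-- the flat ◇₈ seed decides the 𝔄₇ cell (𝔄₇ ⊂ ◇₈). -/
theorem flatSeedA7H1_of_flatSeed8 (h : FlatSeed8H1) : FlatSeedA7H1 :=
  fun C hA hst => h C (inDiamond_of_inA7_cfg hA) hst

/-- and the 𝔄₇ cell is a THINNING statement: it decides the thinning cell of every 𝔄₇-support, in particular `ThinningCell M₃₅`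
(calibration stage T(M₃₅) of the cell spec). -/
theorem thinningCell_of_flatSeedA7 (h : FlatSeedA7H1) {D : MConfig} (hD : CfgInA7 D) : ThinningCell D :=
  fun C hCD hst => h C ⟨fun Z hZ => hD.1 Z (hCD.1 hZ), fun P hP => hD.2 P (hCD.2 hP)⟩ hst

/-- the MIRROR-COMPLETE flat 𝔄₇-cell (rule set `H₁ ∪ A♭₈`; only meaningful once LEMMA A∪2I♭ is signed ×1 — an extra hypothesis, so
`FlatSeedA7H1 → FlatSeedA7H1M`; run and report BOTH per critic price (X1)). -/
def FlatSeedA7H1M : Prop := ∀ C : MConfig, CfgInA7 C → C.StaticH1 → AFlat 8 C → ¬ C.FCCoreBlock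

theorem flatSeedA7H1M_of_H1 (h : FlatSeedA7H1) : FlatSeedA7H1M := fun C hA hst _ => h C hA hst

/-- the mirror-complete thinning cell of a fixed support `D` (calibration stage on the famcore near-models). -/
def ThinningCellM (D : MConfig) : Prop := ∀ C : MConfig, C.sub D → C.StaticH1 → AFlat 8 C → ¬ C.FCCoreBlock

theorem thinningCellM_of (D : MConfig) (h : ThinningCell D) : ThinningCellM D := fun C hC hst _ => h C hC hst

theorem thinningCellM_of_flatSeedA7M (h : FlatSeedA7H1M) {D : MConfig} (hD : CfgInA7 D) : ThinningCellM D :=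
  fun C hC hst hfl => h C ⟨fun Z hZ => hD.1 Z (hC.1 hZ), fun P hP => hD.2 P (hC.2 hP)⟩ hst hfl

/-! ## §7 Where the cell sits relative to THEOREM X∞ (W10, kernel `AdmissibleMu4.no_fc`): outside 𝒰(μ₄) exactly at residue R1 -/

/-- the bare node `2I` is NOT a letter of X∞'s universe 𝒰(μ₄) (memo §7 residue R1 «bare nodes»). [`decide`] -/
theorem bareNode_not_inU : ¬ InUMu4 (2, 0, 0) := by decide

/-- the apex `8I` is NOT a letter of 𝒰(μ₄). [`decide`] -/
theorem apex8_not_inU : ¬ InUMu4 (8, 0, 0) := by decide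

/-- both ARE letters of 𝔄₇, so T(𝔄₇) is not pre-decided by THEOREM X∞. [`decide`] -/
theorem bareNode_apex8_inA7 : InA7 (2, 0, 0) ∧ InA7 (8, 0, 0) := by decide

/-- a fully charged cell in the FC-CORE sense (`FCc`: every `β_f ≠ 0`) is fully charged in X∞'s sense (`FCMu4`: no O-factor). -/
theorem fcMu4_of_fcc {Z : MCell} (h : FCc Z) : FCMu4 Z := fun f e => h f (by rw [e])

/-- **X∞ read for the negation lens** (kernel, from `AdmissibleMu4.no_fc`): a RULE-D-closed, X-clean support with letters in
𝒰(μ₄) that carries one fully charged cell is NOT phase-sibling-closed — inside 𝒰 a survivor must BREAK THE PHASE SYMMETRY at an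
O-carrying `N`-cell (chirality), and otherwise it must LEAVE 𝒰 (bare nodes `2I`, `4I`, `6I`, node-towers, the apex). -/
theorem survivor_breaks_psc {C : MConfig} (hN : ∀ Z ∈ C.lower, ∀ f, InUMu4 (Z f)) (hP : ∀ P ∈ C.upper, ∀ f, InUMu4 (P f))
    (hR : RuleDMu4Closed C) (hX : XCleanMu4 C) {X : MCell} (hXm : X ∈ C.lower ∨ X ∈ C.upper) (hfc : FCc X) : ¬ PSCMu4 C :=
  fun hpsc => AdmissibleMu4.no_fc ⟨hN, hP, hR, hpsc, hX⟩ hXm (fcMu4_of_fcc hfc)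

/-- the diagonal unit cell `N[ℓ₁ ℓ₁ ℓ₁ ℓ₁]` of `M₃₅` (one of its 52 FC cells) is an 𝔄₇-cell inside 𝒰(μ₄) — so on `M₃₅`-type
survivors X∞'s reading bites only through PSC ∕ X-clean, not through the alphabet. [`decide`] -/
theorem diagUnit_inA7_inU : (∀ f : Fin 4, InA7 (mcellOf (lpt 1 0) (lpt 1 0) (lpt 1 0) (lpt 1 0) f)) ∧
    ∀ f : Fin 4, InUMu4 (mcellOf (lpt 1 0) (lpt 1 0) (lpt 1 0) (lpt 1 0) f) := by decide

/-! ## §8 A ghost in miniature (`decide`): the D_ML8 kill pattern of `Pad4TowerA2IMu4` stops firing when its SERVERS are thinned away -/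

/-- head `Z = [O|ℓ₁|ℓ_{i³}|2I]` + its `ℓ₁`-cancellation partner `q` of the D_ML8 pattern, the four `O`-servers of `q` REMOVED. -/
def dml8Thin : MConfig := ⟨{nDML8}, {pDML8}⟩

set_option synthInstance.maxSize 8192 in
set_option synthInstance.maxHeartbeats 2000000 in -- the unfolded family predicates are large decidable instances (as in `Pad4TowerXresFamilies` §5)
/-- **ghost probe**: the thinned pattern is a levelwise sub-support of `dml8Pattern` and is `A2I−`-CLOSED, while the full pattern FIRES
(tree `dml8Pattern_xres`) — the kill's ghost participant is a SERVER (`ghost_participant`, third disjunct). Thinning trades a kill for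
RULE-D service obligations; whether the trade can be closed on a whole FC-CORE support is exactly the solver question T(·) of §6. -/
theorem ghost_probe : dml8Thin.sub dml8Pattern ∧ A2IMinusClosed dml8Thin ∧ ¬ A2IMinusClosed dml8Pattern :=
  ⟨⟨by simp [dml8Thin, dml8Pattern], by simp [dml8Thin, dml8Pattern]⟩, by decide +kernel, dml8Pattern_xres⟩

end Summit.HodgeConjecture.HodgeConjecture.Cruxes.BlochSeedDiscOne.GhostMate
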